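import Summits.CriticalPhenomena.Ising3DConformalLimit.Theses.HarmonicMomentsIsotropy

/-! Post-split verification (crux-strategist r1, instance HMI): the assembly of the BC2 redirect exists BY NAME in the
route file `Theses/HarmonicMomentsIsotropy.lean` (rev 3, commit 0efa074c7b39) and is closed under the standard axioms. -/

open Summit.CriticalPhenomena.Ising3DConformalLimit.Theses in
/-- the pieces are this route's leaves; the parent is derived from them by the rendered glue theorem -/
theorem hmi_parent_of_leaves :
    HarmonicMomentsIsotropy.TwoPointDoubling → HarmonicMomentsIsotropy.ClusterSetTotallyDisconnected →
      HarmonicMomentsIsotropy.ExistsScaleCovariantLimit :=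
  HarmonicMomentsIsotropy.ExistsScaleCovariantLimitGlueBy_holds

open Summit.CriticalPhenomena.Ising3DConformalLimit.Theses in
/-- the leaves ARE items 6150 / 4659 (home decls), definitionally -/
theorem hmi_leaves_are_items :
    (HarmonicMomentsIsotropy.TwoPointDoubling ↔ MirrorHoelderCompactness.TwoPointDoubling) ∧
    (HarmonicMomentsIsotropy.ClusterSetTotallyDisconnected ↔ ClusterRigidity.ClusterSetTotallyDisconnected) :=
  ⟨Iff.rfl, Iff.rfl⟩

open Summit.CriticalPhenomena.Ising3DConformalLimit.Theses in
/-- exactness at this route's copies: parent ⟺ leaf₁ ∧ leaf₂ (p139907 transported by δ) -/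
theorem hmi_parent_iff_leaves :
    HarmonicMomentsIsotropy.ExistsScaleCovariantLimit ↔
      HarmonicMomentsIsotropy.TwoPointDoubling ∧ HarmonicMomentsIsotropy.ClusterSetTotallyDisconnected :=
  Summit.CriticalPhenomena.Ising3DConformalLimit.Cruxes.ExistsScaleCovariantLimit.FoldedCurrentRepulsion.crux_iff_doubling_and_totallyDisconnected

#print axioms Summit.CriticalPhenomena.Ising3DConformalLimit.Theses.HarmonicMomentsIsotropy.ExistsScaleCovariantLimitGlueBy_holds
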